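import Summits.BirchSwinnertonDyer.BirchSwinnertonDyer.Theorems.UniversalToricDescentTwinSplitVanishingControl
import Summits.BirchSwinnertonDyer.BirchSwinnertonDyer.Theorems.CumulativeHeegnerLeopoldtCumulativeHeegnerInclusionAtThreeCellNoThreeTorsion
import Summits.BirchSwinnertonDyer.Rank1Residual.X11b.HalvesReceptacle
import HarnessLib

/-!
# Crux K1 `CumulativeHeegnerInclusionAtThree` (stmt-BirchSwinnertonDyer-24198) / crux A (26896): the
# **VANISHING DOOR** — on the sub-cell where Castella's Selmer group over `K` is trivial and `3 ∤ ∏_w c_w(E/K)`,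
# `Ch_Λ(X_{∅,0}(𝔭′)) = Λ`, so K1's inclusion `span{L} ⊆ Ch_Λ(X)·R₀⟦T⟧` and A's tempered inclusion hold for
# EVERY `L` (no `L`-function input, no Kolyvagin system, no print)

Width seat bsd-line-chl-k1-p1-w2 g7 (`--supports stmt-BirchSwinnertonDyer-24198`). The lineage (58 helper files)
works the INTERIOR of A (`Ch_Λ X = (f)`, `ord₃ f(0) = n ≥ 1`: tempered classes, layer towers, index currencies).
This file records the complementary DEGENERATE door `n = 0`, the CHL twin of the UniversalToricDescent tier-U
"vanishing control" (`…TwinSplitVanishingControl`, p-generic, print-free):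

* §1 (any `K`, `E/K`, `p`, `κ`, `γ`, `𝔭`, `Σ`) `charIdeal_eq_top_of_hasCharValuationAt_zero` — the control shape
  `XAc.HasCharValuationAt … 0` (`X` torsion, `Ch_Λ X = (f)`, `f(0) ≠ 0`, `ord_p f(0) = 0`) forces `Ch_Λ X = ⊤`
  (`f(0) ∈ ℤ_p^× ⟹ f ∈ Λ^×`); hence `map_charIdeal_eq_top_…`, and for every `L ∈ R₀⟦T⟧` the K1-shaped inclusion
  `span_singleton_le_map_charIdeal_of_hasCharValuationAt_zero` and the A-shaped one (`μ = 0`).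
* §2 (the Leopoldt cell of K1: `E/ℚ` of class O6 at `3`, rational line non-anomalous at `3`, `N = N_E`, `K` imaginary
  quadratic Heegner for `N`, ANY `ℤ₃`-extension `κ`, generator `γ`, prime `𝔭′ ∋ 3`)
  `hasCharValuationAt_zero_on_leopoldtCell_of_atoms`: the two NUMERIC ATOMS `3 ∤ ∏_w c_w(E/K)` and
  `Sel_{𝔭′}(K, E[3^∞]) = 0` (`selmerAcBase (E/K) 3 𝔭′ ∅ = ⊥`) give `XAc.HasCharValuationAt (E/K) 3 κ 𝔭′ ∅ γ 0` —
  UTD's `hasCharValuationAt_zero_of_local_descent` with its local input above `𝔭′` (`E(K_{∞,w})[3^∞] = 0`)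
  DISCHARGED by the cell (`…CellNoThreeTorsion.cell_fixedPoints_decomp_inf_kerSubgroup_eq_bot`, the non-anomalous
  clause) and the away descent by `localKer_eq_bot_of_not_dvd_tamagawaProduct`.
* §3 `cumulativeHeegnerInclusionAtThree_pointwise_of_atoms` / `temperedHeegnerInclusionAtThree_pointwise_of_atoms`:
  on that sub-cell the CONCLUSIONS of K1 and of A hold verbatim for every `κ, γ, 𝔭′` and EVERY `L : UnrSeries 3`
  (so in particular for the BDP measure of the crux, whatever `ι′, Ω_K, Ω_p, Dt` are).

READING (numbers, not adjectives): K1/A quantify over ALL curves of the cell; this door decides them only POINTWISE on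
the sub-cell `{3 ∤ Tam(E/K)} ∩ {Sel_{𝔭′}(K, E[3^∞]) = 0}` (where in fact `Sel_{𝔭′}(K_∞, E[3^∞]) = 0`, UTD §2, and BSD₃ is
3-trivial on both sides); the research content of A (census A26896-LINE-CENSUS-g6 §2) is untouched and confined to
`n ≥ 1`. The second atom is a `3`-descent statement over `K` (not proved here for any curve; a printed `T = 0`
instrument toward it on this very cell — unit `𝔭`-adic logarithm of `y_K` at an Eisenstein `p` with `p ∣ N` allowed —
is Kriz–Li, Forum Math. Sigma 7 (2019) e15, Thm. 1.20). THEOREMS ONLY: no definition, no named fact, no `sorry`;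
imports no `Theses` module (route-independent). BSD is not proved by any of this; no summit statement is proved
by this seat; K1 24198 and A 26896 stay OPEN.

References: [GreenbergLNM1716] §1, §3 (pp. 85–90), §4 Lemma 4.2; [Castella2018] Thm. 2.3 (the shape `#ℤ_p/f(0)`);
[Castella2018Erratum] Thm. 1.1 (iv); [JetchevSkinnerWan2017] §3.3; [KrizLi2019] Thm. 1.20 / 7.1;
[Washington1997] §13.2; [BourbakiAC5to7] VII §4 no. 5.
-/

set_option linter.dupNamespace false
set_option autoImplicit false

noncomputable section

open scoped Classical

open NumberField IsDedekindDomain Field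
open Literature.NumberTheory.EllipticCurves Literature.NumberTheory.EllipticCurves.GreenbergSelmer
open Literature.NumberTheory.GaloisRepresentations

namespace Summit.BirchSwinnertonDyer.BirchSwinnertonDyer.Theorems.CumulativeHeegnerInclusionAtThreeVanishingDoor

open Summit.BirchSwinnertonDyer.Rank1Residual.X11b
open Summit.BirchSwinnertonDyer.Rank1Residual.X11b.AcSelmer
open Summit.BirchSwinnertonDyer.Rank1Residual.X11b.Halves
open Summit.BirchSwinnertonDyer.BirchSwinnertonDyer.Theorems.UniversalToricDescentTwinSplit.VanishingControl
open Summit.BirchSwinnertonDyer.BirchSwinnertonDyer.Theorems.CumulativeHeegnerInclusionAtThreeCellNoThreeTorsion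

/-! ## §1 The control shape at valuation `0` forces the unit characteristic ideal (pure `Λ`-algebra) -/

section Shape

variable {K : Type} [Field K] [NumberField K] (E : WeierstrassCurve K) (p : ℕ) [Fact p.Prime]
  (κ : ZpExtension K p) (𝔭 : HeightOneSpectrum (𝓞 K)) (S : Set (HeightOneSpectrum (𝓞 K)))
  (γ : absoluteGaloisGroup K) [Fact (κ.IsTopGenerator γ)]

/-- A power series over `ℤ_p` whose constant coefficient is non-zero of `p`-adic valuation `0` is a unit of
`Λ = ℤ_p⟦T⟧`. [cite: Washington1997, §7.1 (units of `Λ`)] -/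
theorem isUnit_of_valuation_constantCoeff_eq_zero {f : IwasawaAlgebra p}
    (hf0 : PowerSeries.constantCoeff f ≠ 0) (hval : (PowerSeries.constantCoeff f).valuation = 0) :
    IsUnit f := by
  rw [PowerSeries.isUnit_iff_constantCoeff]
  rw [PadicInt.isUnit_iff, PadicInt.norm_eq_zpow_neg_valuation hf0, hval]
  simp

/-- **`XAc.HasCharValuationAt … 0 ⟹ Ch_Λ(X_ac^Σ) = Λ`.** If `X_ac^Σ` is torsion with `Ch_Λ = (f)`, `f(0) ≠ 0`
and `ord_p f(0) = 0`, then `f` is a unit of `Λ` and the characteristic ideal is the unit ideal (converse of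
`VanishingControl.hasCharValuationAt_zero_of_subsingleton`'s last step). [cite: Castella2018, Thm. 2.3 (shape `#ℤ_p/f(0)`)] -/
theorem charIdeal_eq_top_of_hasCharValuationAt_zero (h : XAc.HasCharValuationAt E p κ 𝔭 S γ 0) :
    XAc.charIdeal E p κ 𝔭 S γ = ⊤ := by
  obtain ⟨-, f, hf, hf0, hval⟩ := h
  rw [hf, Ideal.span_singleton_eq_top]
  exact isUnit_of_valuation_constantCoeff_eq_zero p hf0 (by exact_mod_cast hval)

/-- … hence its image in `Λ^ur = R₀⟦T⟧` is the unit ideal. [folklore] -/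
theorem map_charIdeal_eq_top_of_hasCharValuationAt_zero (h : XAc.HasCharValuationAt E p κ 𝔭 S γ 0) :
    (XAc.charIdeal E p κ 𝔭 S γ).map (PowerSeries.map (toUnr p)) = ⊤ := by
  rw [charIdeal_eq_top_of_hasCharValuationAt_zero E p κ 𝔭 S γ h, Ideal.map_top]

/-- **K1-shaped inclusion at valuation `0`, for EVERY `L`.** `span{L} ⊆ Ch_Λ(X_ac^Σ)·R₀⟦T⟧`. [folklore] -/
theorem span_singleton_le_map_charIdeal_of_hasCharValuationAt_zero
    (h : XAc.HasCharValuationAt E p κ 𝔭 S γ 0) (L : UnrSeries p) :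
    Ideal.span {L} ≤ (XAc.charIdeal E p κ 𝔭 S γ).map (PowerSeries.map (toUnr p)) := by
  rw [map_charIdeal_eq_top_of_hasCharValuationAt_zero E p κ 𝔭 S γ h]
  exact le_top

/-- **A-shaped (tempered) inclusion at valuation `0`, for EVERY `L`**, with `μ = 0`. [folklore] -/
theorem exists_span_pow_mul_le_map_charIdeal_of_hasCharValuationAt_zero
    (h : XAc.HasCharValuationAt E p κ 𝔭 S γ 0) (L : UnrSeries p) :
    ∃ μ : ℕ, Ideal.span {(p : UnrSeries p) ^ μ * L} ≤
      (XAc.charIdeal E p κ 𝔭 S γ).map (PowerSeries.map (toUnr p)) :=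
  ⟨0, by rw [map_charIdeal_eq_top_of_hasCharValuationAt_zero E p κ 𝔭 S γ h]; exact le_top⟩

end Shape

/-! ## §2 The Leopoldt cell: the local input above `𝔭′` is a theorem, two numeric atoms remain -/

section Cell

/-- **Vanishing control on the Leopoldt cell from two numeric atoms.** For `E/ℚ` of class O6 at `3` with a
rational line `Φ ≤ E[3]` non-anomalous at `3`, `N = N_E`, `K` imaginary quadratic satisfying the Heegner
hypothesis for `N`, ANY `ℤ₃`-extension `κ` of `K` with topological generator `γ`, and any prime `𝔭′ ∋ 3` of `K`:
if `3 ∤ ∏_w c_w(E/K)` and Castella's Selmer group `Sel_{𝔭′}(K, E[3^∞])` is trivial, then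
`XAc.HasCharValuationAt (E/K) 3 κ 𝔭′ ∅ γ 0` (`X_{∅,0}(𝔭′)` torsion with unit characteristic ideal). The local
torsion-freeness above `𝔭′` along the tower is the cell's `cell_fixedPoints_decomp_inf_kerSubgroup_eq_bot`; the
away descent is `ker r_v = 0` from the Tamagawa atom; then UTD's `hasCharValuationAt_zero_of_local_descent`.
[cite: GreenbergLNM1716, §3 p. 90 and §4 Lemma 4.2] [cite: Castella2018Erratum, Thm. 1.1 (iv)] -/
theorem hasCharValuationAt_zero_on_leopoldtCell_of_atoms :
    ∀ (W : WeierstrassCurve ℚ) [W.IsElliptic] [W.IsGloballyMinimal] (N : ℕ) [NeZero N] (K : Type) [Field K]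
      [NumberField K], Summit.BirchSwinnertonDyer.Rank1Residual.Additive.ClassO6 W 3 →
      (∃ Φ : AddSubgroup (WeierstrassCurve.geomTorsion W ((3 : ℕ) : ℤ)),
        Literature.NumberTheory.EllipticCurves.Rank1Residual.IsRationalLine W 3 Φ ∧
        ∀ (v : IsDedekindDomain.HeightOneSpectrum (NumberField.RingOfIntegers ℚ)),
          ((3 : ℕ) : NumberField.RingOfIntegers ℚ) ∈ v.asIdeal → ∀ 𝔓 ∈ v.primesAbove,
          ¬ (∀ g ∈ 𝔓.decompositionSubgroup (Field.absoluteGaloisGroup ℚ), ∀ P ∈ Φ, g • P = P) ∧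
          ¬ (∀ g ∈ 𝔓.decompositionSubgroup (Field.absoluteGaloisGroup ℚ),
              ∀ P : WeierstrassCurve.geomTorsion W ((3 : ℕ) : ℤ), g • P - P ∈ Φ)) →
      W.conductorNorm ℤ = N → Literature.NumberTheory.EllipticCurves.IsImaginaryQuadratic K →
      Literature.NumberTheory.EllipticCurves.SatisfiesHeegnerHypothesis N K →
      ∀ (κ : Literature.NumberTheory.EllipticCurves.ZpExtension K 3) (γ : Field.absoluteGaloisGroup K)
        [Fact (κ.IsTopGenerator γ)]
        (𝔭' : IsDedekindDomain.HeightOneSpectrum (NumberField.RingOfIntegers K)),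
        ((3 : ℕ) : NumberField.RingOfIntegers K) ∈ 𝔭'.asIdeal →
      haveI : (W.baseChange K).IsElliptic := inferInstanceAs (W.map (algebraMap ℚ K)).IsElliptic
      ¬ 3 ∣ (W.baseChange K).tamagawaProduct →
      selmerAcBase (W.baseChange K) 3 𝔭' ∅ = ⊥ →
      XAc.HasCharValuationAt (W.baseChange K) 3 κ 𝔭' ∅ γ 0 := by
  intro W _ _ N _ K _ _ hO6 hline hN hK hHg κ γ _ 𝔭' h𝔭' htam hbase
  haveI : Fact (Nat.Prime 3) := ⟨Nat.prime_three⟩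
  haveI hEK : (W.baseChange K).IsElliptic := inferInstanceAs (W.map (algebraMap ℚ K)).IsElliptic
  haveI : IsTotallyComplex K := IsImaginaryQuadratic.isTotallyComplex hK
  have h0 := cell_fixedPoints_decomp_inf_kerSubgroup_eq_bot W N K hO6 hline hN hK hHg κ 𝔭' h𝔭'
  have hker : ∀ v : HeightOneSpectrum (𝓞 K), ((3 : ℕ) : 𝓞 K) ∉ v.asIdeal →
      localKer κ.kerSubgroup ((W.baseChange K).geomPrimaryTorsion 3) v = ⊥ := fun v hv ↦
    localKer_eq_bot_of_not_dvd_tamagawaProduct (W.baseChange K) 3 κ htam hv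
  exact hasCharValuationAt_zero_of_local_descent (W.baseChange K) 3 κ 𝔭' ∅ γ h0
    (fun _ hc v hv hvS ↦ mem_awayKer_of_localKer_eq_bot hv hvS (hker v hv) hc) hbase

end Cell

/-! ## §3 Pointwise K1 / A on the vanishing sub-cell -/

section Pointwise

/-- **Pointwise K1 on the vanishing sub-cell.** On the Leopoldt cell (class O6 at `3`, non-anomalous rational line,
`N = N_E`, `K` imaginary quadratic Heegner for `N`), for any `ℤ₃`-extension `κ`, generator `γ`, prime `𝔭′ ∋ 3`:
if `3 ∤ ∏_w c_w(E/K)` and `Sel_{𝔭′}(K, E[3^∞]) = 0`, then for EVERY `L : UnrSeries 3`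
`span{L} ≤ (XAc.charIdeal (E/K) 3 κ 𝔭′ ∅ γ).map toUnr` — verbatim the conclusion of crux K1
`CumulativeHeegnerInclusionAtThree` for this `(E, K, κ, γ, 𝔭′)` and every BDP-type `L` (indeed every `L`).
Closes nothing by itself: K1 quantifies over the whole cell. [cite: GreenbergLNM1716, §4 Lemma 4.2] -/
theorem cumulativeHeegnerInclusionAtThree_pointwise_of_atoms :
    ∀ (W : WeierstrassCurve ℚ) [W.IsElliptic] [W.IsGloballyMinimal] (N : ℕ) [NeZero N] (K : Type) [Field K]
      [NumberField K], Summit.BirchSwinnertonDyer.Rank1Residual.Additive.ClassO6 W 3 →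
      (∃ Φ : AddSubgroup (WeierstrassCurve.geomTorsion W ((3 : ℕ) : ℤ)),
        Literature.NumberTheory.EllipticCurves.Rank1Residual.IsRationalLine W 3 Φ ∧
        ∀ (v : IsDedekindDomain.HeightOneSpectrum (NumberField.RingOfIntegers ℚ)),
          ((3 : ℕ) : NumberField.RingOfIntegers ℚ) ∈ v.asIdeal → ∀ 𝔓 ∈ v.primesAbove,
          ¬ (∀ g ∈ 𝔓.decompositionSubgroup (Field.absoluteGaloisGroup ℚ), ∀ P ∈ Φ, g • P = P) ∧
          ¬ (∀ g ∈ 𝔓.decompositionSubgroup (Field.absoluteGaloisGroup ℚ),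
              ∀ P : WeierstrassCurve.geomTorsion W ((3 : ℕ) : ℤ), g • P - P ∈ Φ)) →
      W.conductorNorm ℤ = N → Literature.NumberTheory.EllipticCurves.IsImaginaryQuadratic K →
      Literature.NumberTheory.EllipticCurves.SatisfiesHeegnerHypothesis N K →
      ∀ (κ : Literature.NumberTheory.EllipticCurves.ZpExtension K 3) (γ : Field.absoluteGaloisGroup K)
        [Fact (κ.IsTopGenerator γ)]
        (𝔭' : IsDedekindDomain.HeightOneSpectrum (NumberField.RingOfIntegers K)),
        ((3 : ℕ) : NumberField.RingOfIntegers K) ∈ 𝔭'.asIdeal →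
      haveI : (W.baseChange K).IsElliptic := inferInstanceAs (W.map (algebraMap ℚ K)).IsElliptic
      ¬ 3 ∣ (W.baseChange K).tamagawaProduct →
      selmerAcBase (W.baseChange K) 3 𝔭' ∅ = ⊥ →
      ∀ L : Literature.NumberTheory.EllipticCurves.UnrSeries 3,
        Ideal.span {L} ≤ (Summit.BirchSwinnertonDyer.Rank1Residual.X11b.AcSelmer.XAc.charIdeal
          (W.baseChange K) 3 κ 𝔭' ∅ γ).map
            (PowerSeries.map (Summit.BirchSwinnertonDyer.Rank1Residual.X11b.Halves.toUnr 3)) := by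
  intro W _ _ N _ K _ _ hO6 hline hN hK hHg κ γ _ 𝔭' h𝔭' htam hbase L
  haveI : Fact (Nat.Prime 3) := ⟨Nat.prime_three⟩
  exact span_singleton_le_map_charIdeal_of_hasCharValuationAt_zero (W.baseChange K) 3 κ 𝔭' ∅ γ
    (hasCharValuationAt_zero_on_leopoldtCell_of_atoms W N K hO6 hline hN hK hHg κ γ 𝔭' h𝔭' htam hbase) L

/-- **Pointwise A (tempered inclusion, `μ = 0`) on the vanishing sub-cell** — verbatim the conclusion shape of
crux A `TemperedHeegnerInclusionAtThree` (stmt-26896) for this `(E, K, κ, γ, 𝔭′)` and every `L`.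
Closes nothing by itself. [cite: GreenbergLNM1716, §4 Lemma 4.2] -/
theorem temperedHeegnerInclusionAtThree_pointwise_of_atoms :
    ∀ (W : WeierstrassCurve ℚ) [W.IsElliptic] [W.IsGloballyMinimal] (N : ℕ) [NeZero N] (K : Type) [Field K]
      [NumberField K], Summit.BirchSwinnertonDyer.Rank1Residual.Additive.ClassO6 W 3 →
      (∃ Φ : AddSubgroup (WeierstrassCurve.geomTorsion W ((3 : ℕ) : ℤ)),
        Literature.NumberTheory.EllipticCurves.Rank1Residual.IsRationalLine W 3 Φ ∧
        ∀ (v : IsDedekindDomain.HeightOneSpectrum (NumberField.RingOfIntegers ℚ)),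
          ((3 : ℕ) : NumberField.RingOfIntegers ℚ) ∈ v.asIdeal → ∀ 𝔓 ∈ v.primesAbove,
          ¬ (∀ g ∈ 𝔓.decompositionSubgroup (Field.absoluteGaloisGroup ℚ), ∀ P ∈ Φ, g • P = P) ∧
          ¬ (∀ g ∈ 𝔓.decompositionSubgroup (Field.absoluteGaloisGroup ℚ),
              ∀ P : WeierstrassCurve.geomTorsion W ((3 : ℕ) : ℤ), g • P - P ∈ Φ)) →
      W.conductorNorm ℤ = N → Literature.NumberTheory.EllipticCurves.IsImaginaryQuadratic K →
      Literature.NumberTheory.EllipticCurves.SatisfiesHeegnerHypothesis N K →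
      ∀ (κ : Literature.NumberTheory.EllipticCurves.ZpExtension K 3) (γ : Field.absoluteGaloisGroup K)
        [Fact (κ.IsTopGenerator γ)]
        (𝔭' : IsDedekindDomain.HeightOneSpectrum (NumberField.RingOfIntegers K)),
        ((3 : ℕ) : NumberField.RingOfIntegers K) ∈ 𝔭'.asIdeal →
      haveI : (W.baseChange K).IsElliptic := inferInstanceAs (W.map (algebraMap ℚ K)).IsElliptic
      ¬ 3 ∣ (W.baseChange K).tamagawaProduct →
      selmerAcBase (W.baseChange K) 3 𝔭' ∅ = ⊥ →
      ∀ L : Literature.NumberTheory.EllipticCurves.UnrSeries 3,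
        ∃ μ : ℕ, Ideal.span {(3 : Literature.NumberTheory.EllipticCurves.UnrSeries 3) ^ μ * L} ≤
          (Summit.BirchSwinnertonDyer.Rank1Residual.X11b.AcSelmer.XAc.charIdeal
            (W.baseChange K) 3 κ 𝔭' ∅ γ).map
              (PowerSeries.map (Summit.BirchSwinnertonDyer.Rank1Residual.X11b.Halves.toUnr 3)) := by
  intro W _ _ N _ K _ _ hO6 hline hN hK hHg κ γ _ 𝔭' h𝔭' htam hbase L
  haveI : Fact (Nat.Prime 3) := ⟨Nat.prime_three⟩
  have h := exists_span_pow_mul_le_map_charIdeal_of_hasCharValuationAt_zero (W.baseChange K) 3 κ 𝔭' ∅ γ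
    (hasCharValuationAt_zero_on_leopoldtCell_of_atoms W N K hO6 hline hN hK hHg κ γ 𝔭' h𝔭' htam hbase) L
  simpa using h

end Pointwise

end Summit.BirchSwinnertonDyer.BirchSwinnertonDyer.Theorems.CumulativeHeegnerInclusionAtThreeVanishingDoor

end
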